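import Mathlib.FieldTheory.Finite.Basic
import Mathlib.RingTheory.RootsOfUnity.PrimitiveRoots
import Mathlib.GroupTheory.SpecificGroups.Cyclic
import Mathlib.Tactic
import HarnessLib

/-!
# Route `AdditiveKolyvaginRoad`, crux KS′ `LevelKolyvaginSystemsAdditive` (item stmt-BirchSwinnertonDyer-21396): DISCRETE-LOG SYSTEMS EXIST
# — the second non-vacuity brick of the Kurihara clause of crux card `kurihara-lower-half` (`KuriharaLowerHalf.IsDiscreteLogSystem`)
# (cell `pub/bsd-wall`, width seat `bsd-wall-akr-p2x-w4` g6; `--supports stmt-BirchSwinnertonDyer-21396`, helper)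

THEOREMS ONLY (no definition, no named fact, no `sorry`); Mathlib-only content.  BSD is not proved by any of this; nothing about Kurihara
NUMBERS is claimed.

THE POINT.  The Kurihara clause of the card's sketch (`RamifiedHabitatKuriharaSlotSketch.lean` §2) reads
`∃ n g dl, IsKuriharaLevel W p n ∧ IsDiscreteLogSystem n g dl ∧ δ_n ≠ 0 ∧ ord_p δ_n = 0` with
`IsDiscreteLogSystem n g dl := ∀ ℓ ∈ n.primeFactors, IsPrimitiveRoot (g ℓ : ZMod ℓ) (ℓ − 1) ∧ ∀ a, a.Coprime n → (g ℓ : ZMod ℓ)^(dl ℓ a) = a`.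
Kurihara LEVELS exist above every bound (`KuriharaRoad.exists_kuriharaLevel_card_eq`, sibling file); this file shows that a
DISCRETE-LOG SYSTEM exists for EVERY `n` (primitive roots modulo the primes of `n` and discrete logarithms of the residues prime to `n`)
— so the only content of the clause is the unit Kurihara number:

* `exists_isPrimitiveRoot_and_dlog` — modulo a prime `ℓ` there is `g < ℓ` with `(g : ZMod ℓ)` a primitive `(ℓ−1)`-th root of unity,
  and every `a` prime to `ℓ` is a power `g^k`, `k : ℕ` (the unit group of `𝔽_ℓ` is cyclic).
* `exists_isDiscreteLogSystem` — for every `n`, functions `g : ℕ → ℕ`, `dl : ℕ → ℕ → ℕ` with the sketch's `IsDiscreteLogSystem n g dl`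
  VERBATIM (unfolded).

[folklore] (Gauss; Mathlib `ZMod` units cyclic).
-/

-- single-conjunct summit: `Summit.BirchSwinnertonDyer.BirchSwinnertonDyer.…` repeats the name by design
set_option linter.dupNamespace false
set_option autoImplicit false

namespace Summit.BirchSwinnertonDyer.BirchSwinnertonDyer.Theorems.AdditiveKoly.KuriharaRoad

/-- **A primitive root and discrete logarithms modulo a prime.**  For a prime `ℓ` there is `g < ℓ` such that `(g : ZMod ℓ)` is a
primitive `(ℓ − 1)`-th root of unity and every `a` prime to `ℓ` satisfies `(g : ZMod ℓ)^k = a` for some `k : ℕ`. [folklore] -/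
theorem exists_isPrimitiveRoot_and_dlog (ℓ : ℕ) (hℓ : ℓ.Prime) :
    ∃ g : ℕ, g < ℓ ∧ IsPrimitiveRoot (g : ZMod ℓ) (ℓ - 1) ∧
      ∀ a : ℕ, Nat.Coprime a ℓ → ∃ k : ℕ, (g : ZMod ℓ) ^ k = (a : ZMod ℓ) := by
  haveI : Fact ℓ.Prime := ⟨hℓ⟩
  obtain ⟨u, hu⟩ := IsCyclic.exists_generator (α := (ZMod ℓ)ˣ)
  have hord : orderOf u = ℓ - 1 := by
    rw [orderOf_eq_card_of_forall_mem_zpowers hu, Nat.card_eq_fintype_card, ZMod.card_units]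
  refine ⟨(u : ZMod ℓ).val, ZMod.val_lt _, ?_, fun a ha ↦ ?_⟩
  · rw [ZMod.natCast_zmod_val, IsPrimitiveRoot.coe_units_iff, ← hord]
    exact IsPrimitiveRoot.orderOf u
  · set x : (ZMod ℓ)ˣ := ZMod.unitOfCoprime a ha with hx
    have hxmem : x ∈ Submonoid.powers u := (mem_powers_iff_mem_zpowers).mpr (hu x)
    obtain ⟨k, hk⟩ := (Submonoid.mem_powers_iff _ _).mp hxmem
    refine ⟨k, ?_⟩
    rw [ZMod.natCast_zmod_val, ← Units.val_pow_eq_pow_val, hk, hx, ZMod.coe_unitOfCoprime]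

/-- **DISCRETE-LOG SYSTEMS EXIST** (the sketch's `KuriharaLowerHalf.IsDiscreteLogSystem n g dl`, VERBATIM, for every `n`): there are
`g : ℕ → ℕ` and `dl : ℕ → ℕ → ℕ` with, for every prime `ℓ ∣ n`, `(g ℓ : ZMod ℓ)` a primitive `(ℓ−1)`-th root of unity and
`(g ℓ : ZMod ℓ)^(dl ℓ a) = a` for every `a` prime to `n`. [folklore] -/
theorem exists_isDiscreteLogSystem (n : ℕ) :
    ∃ (g : ℕ → ℕ) (dl : ℕ → ℕ → ℕ), ∀ ℓ ∈ n.primeFactors,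
      IsPrimitiveRoot (g ℓ : ZMod ℓ) (ℓ - 1) ∧ ∀ a : ℕ, Nat.Coprime a n → (g ℓ : ZMod ℓ) ^ (dl ℓ a) = (a : ZMod ℓ) := by
  classical
  -- a primitive root modulo every prime (junk `0` at non-primes)
  have hg : ∀ ℓ : ℕ, ∃ g : ℕ, ℓ.Prime → IsPrimitiveRoot (g : ZMod ℓ) (ℓ - 1) ∧
      ∀ a : ℕ, Nat.Coprime a ℓ → ∃ k : ℕ, (g : ZMod ℓ) ^ k = (a : ZMod ℓ) := by
    intro ℓ
    by_cases h : ℓ.Prime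
    · obtain ⟨g, -, hprim, hdl⟩ := exists_isPrimitiveRoot_and_dlog ℓ h
      exact ⟨g, fun _ ↦ ⟨hprim, hdl⟩⟩
    · exact ⟨0, fun h' ↦ absurd h' h⟩
  choose g hg using hg
  -- discrete logarithms (junk `0` where undefined)
  have hdl : ∀ ℓ a : ℕ, ∃ k : ℕ, ℓ.Prime → Nat.Coprime a ℓ → (g ℓ : ZMod ℓ) ^ k = (a : ZMod ℓ) := by
    intro ℓ a
    by_cases h : ℓ.Prime ∧ Nat.Coprime a ℓ
    · obtain ⟨k, hk⟩ := (hg ℓ h.1).2 a h.2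
      exact ⟨k, fun _ _ ↦ hk⟩
    · exact ⟨0, fun h1 h2 ↦ absurd ⟨h1, h2⟩ h⟩
  choose dl hdl using hdl
  refine ⟨g, dl, fun ℓ hℓ ↦ ?_⟩
  have hℓp : ℓ.Prime := Nat.prime_of_mem_primeFactors hℓ
  have hℓn : ℓ ∣ n := Nat.dvd_of_mem_primeFactors hℓ
  exact ⟨(hg ℓ hℓp).1, fun a ha ↦ hdl ℓ a hℓp (Nat.Coprime.coprime_dvd_right hℓn ha)⟩

end Summit.BirchSwinnertonDyer.BirchSwinnertonDyer.Theorems.AdditiveKoly.KuriharaRoad
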